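import Literature.Geometry.Lorentzian.KlainermanSzeftel2021.Dag
import Literature.Geometry.Lorentzian.KlainermanSzeftel2021.IterationAbsorption

/-!
# Klainerman–Szeftel §9.4.8 Step 2 via Giorgi–Klainerman–Szeftel (13.6.8): the iteration step "E-M8" over `Ch9Iteration`

CITATION HEADER (lean-in-tree rule 2026-08-18).  Sources as in the two imported modules:
* S. Klainerman, J. Szeftel, *Kerr stability for small angular momentum*, arXiv:2104.11857 (v1, 2021; TeX source
  `Main-Kerr-arxiv.tex`, lines `KS l.N`) = bib key `KlainermanSzeftel2021`; journal record Pure Appl. Math. Q. **19**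
  (2023) no. 3, 791–1678 = `KlainermanSzeftel2023` (refereed; not separately read — acquisition acq-07685 of the audit cell);
* E. Giorgi, S. Klainerman, J. Szeftel, *Wave equations estimates and the nonlinear stability of slowly rotating Kerr black
  holes*, arXiv:2205.14808 (v1, 2022; TeX `FinalKerrarxivversion.tex`, lines `GKS l.N`) = `GiorgiKlainermanSzeftel2022`;
  journal record Pure Appl. Math. Q. **20** (2024) no. 7, 2865–3849 = `GiorgiKlainermanSzeftel2024` (refereed; authors'
  version HAL hal-05348127v1, pages `HAL p.N`).

WHAT IS REPRODUCED, and in what sense.  ONE bookkeeping edge of the architecture, kernel-checked as real arithmetic over the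
carrier record `Ch9Iteration` of `Dag.lean` (KS Def. 9.4.9 / (9.4.26)–(9.4.34), KS l.24380–24452): the step `J ↦ J+1` of the
iteration of KS §9.4.8 Step 2 (KS l.24613–24631), NOT from KS's own Corollary 9.4.21 via the arXiv-v1 Theorem 9.4.15 ("FORM A",
linear and `a`-free, KS l.24481–24490, whose proof KS defers to "[KS:Kerr-B]"), but from what GKS actually proves in its place —
Theorem 13.6.3 / Remark 13.6.4, consequence (13.6.8) (GKS l.25953–25983; journal (13.6.9), HAL p.627, "where the constant in ≲
is independent of r₀"), typed verbatim as `Ch9Iteration.Thm1363_formB` — together with KS Propositions 9.4.17–9.4.20 (KS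
l.24496–24545, typed as `Ch9Iteration.Props9417to9420`).  The theorem `Ch9Iteration.iter_step_of_GKS_13_6_8` says: for `J` in
BOTH printed ranges (GKS: `k_L/2 ≤ J ≤ k_L − 1`; KS: `k_small − 1 ≤ J ≤ k_large + 6`), under (13.6.8)'s hypotheses at `J`, the
four Ricci estimates with one constant `Cks`, regional ≤ global for `ℜ` at level `J+1` (KS (9.4.7)–(9.4.9), l.24004–24010),
`𝔖_{J+1} ≤` the sum of its four regional parts, signs, `r₀ > 0`, a Young parameter `η > 0`, and the two SMALLNESS CONDITIONS
  `hr0 : (Cgks · r₀^{−δ_B/2}) · Cks (Cks+1) ≤ 1/4`                 ("r₀ large" — meetable because 9.4.17/9.4.18's constant is r₀-free),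
  `ha  : (Cgks · √|a| · r₀^{3+δ_B/2} + θ(η)) · 4 (Cks+1)³ ≤ 1/4`    ("η and |a| small AFTER r₀ is fixed"; θ = `IterationAbsorption.thetaOf`),
one has `ℜ_{J+1} + 𝔖_{J+1} ≤ (1 + 4(Cks+1)³)(2 A(η) + ε₀ + L_*(J+1)/2) + 4(Cks+1)³(ε₀ + L_*(J+1))` with
`A(η) = IterationAbsorption.dataOf …` — i.e. "(13.6.4) at J+1" with an `(r₀, η, Cks)`-dependent constant, which is the use KS
§9.4.8 Step 2 makes of Cor 9.4.21.  The order of the smallness choices (first `r₀`, then `|a|`) is the one GKS prints (GKS l.26758,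
l.26916) and KS v1 (3.4.1)–(3.4.4) (KS l.6075–6094) does not: this is locus A10/G-1 of the audit cell's `|a| ≪ M` census, here
in kernel-checked form.  WHAT IT DOES NOT SAY: it does not produce `Ch9Iteration.KS_Cor_9_4_21_of_GKS_13_6_3` literally (that
shape keeps KS's FORM-A constants `C r₀^{−δ_B}` in front of `L` and `C r₀^{10}` in front of `ℜ_J + 𝔖_J`, which FORM B does not give),
and it says nothing for `k_small − 1 ≤ J < k_L/2` (the J-range mismatch between KS (9.4.33) and GKS Thm 13.6.3; cell files
GAPS.md G-1, LEMMAS.md FR-8).  No estimate of either paper is asserted: both displays enter as HYPOTHESES (`hB`, `hP`).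

Proof: elementary real arithmetic (0 sorry, axioms ⊆ {propext, Classical.choice, Quot.sound}) — the instance of (13.6.8) at `J`
is redistributed into the shape consumed by `IterationAbsorption.iterate_of_remark1364_named` (Young / weighted AM–GM
linearisation of the three sublinear terms, then the two linear absorptions), and the four Ricci estimates are summed by
`IterationAbsorption.S_le_of_props`.

RELATION TO EXISTING TREE MATERIAL.  Consumes `Dag.lean` (`Ch9Iteration` and its node shapes, name-stable) and
`IterationAbsorption.lean` (the arithmetic core); `BridgeDag.lean` instantiates `Ch9Iteration` from Setup's PT norms
(`Bridge.ch9Of`), so this theorem applies verbatim to the schematic PT norms of `Setup.lean` under the finiteness hypotheses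
stated there.  No relation to `StabilityCauchy.lean` / `Stability.lean` / `Kerr*.lean` / the Hintz claim file.  Nothing here
is Final-State-Conjecture progress: value = one kernel-checked bookkeeping edge of a typed skeleton with its smallness
conditions explicit, per the audit cell's contract.

STAGING.  = the cell's staged module `KerrSkeleton/Nodes/EM8Dag.lean` (md5 4cdc89db…, clean-built in the staging package
2026-08-18T14:41Z and in every later clean build), code unchanged except: imports/namespace moved under the tree path
(`KerrSkeleton.Ch9Iteration` → `Literature.Geometry.Lorentzian.KlainermanSzeftel2021.Ch9Iteration`, `KerrSkeleton.Nodes.EM8`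
→ `…KlainermanSzeftel2021.IterationAbsorption`), the section `variable` turned into an explicit binder, docstring completed.
v2 (2026-08-18, carver-g9 as LEAD, companion of `Dag` v9 = DIVERGENCE DV-f3-11): the J-range hypothesis `hJ1` is the
printed GKS floor "k_L/2 ≤ J" read EXACTLY for integer `J`, `I.kL ≤ 2 * J` (⟺ `k_small + 3 ≤ J`; v1 had the ℕ-division reading
`I.kL / 2 ≤ J`, one level weaker for even `k_large`), and the instance of (13.6.8) at `J` is taken from `hB` by `omega`, which elaborates
under both typings of the node's floor binder (`Dag` ≤ v8 `I.kL / 2 ≤ J`, `Dag` v9 `I.kL ≤ 2 * J`); statement otherwise and proof unchanged.  Staged twin `Nodes/EM8Dag.lean` v2 = the same two-line change, clean-built with `Dag` v9.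
-/

noncomputable section

namespace Literature.Geometry.Lorentzian.KlainermanSzeftel2021
namespace Ch9Iteration

open IterationAbsorption (thetaOf dataOf S_le_of_props iterate_of_remark1364_named)

/-- **E-M8, kernel-checked form** (KS §9.4.8 Step 2, l.24613–24631, run on GKS (13.6.8) instead of KS v1 Thm 9.4.15):
[GKS] (13.6.8) at `J` ∧ [KS] Props 9.4.17–9.4.20 at `J` ∧ (`r₀` large: `hr0`) ∧ (`η`, `|a|` small after `r₀`: `ha`)
⟹ the iteration bound at `J+1`, with every constant explicit.  Both displays are hypotheses; nothing is asserted.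
v2: `hJ1` is the printed GKS floor "k_L/2 ≤ J" (l.25955, PAMQ PDF p. 627 L64) read exactly for integer `J`, `I.kL ≤ 2 * J`
(⟺ `k_small + 3 ≤ J`); the node's floor binder in `hB` is discharged by `omega` under either typing (DIVERGENCE DV-f3-11).
[cite: KlainermanSzeftel2021, §9.4.8 Step 2 with Cor 9.4.21 / Props 9.4.17–9.4.20, TeX l.24496–24631; GiorgiKlainermanSzeftel2022, Remark 13.6.4 (13.6.8) (journal (13.6.9), HAL p.627), TeX l.25974–25983] -/
theorem iter_step_of_GKS_13_6_8 (I : Ch9Iteration)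
    (H1363 : ℕ → Prop) (Cgks Cks η : ℝ) (J : ℕ)
    (hB : I.Thm1363_formB H1363 Cgks) (hP : I.Props9417to9420 Cks)
    -- J in both ranges, and the hypotheses of (13.6.8) at J
    (hJ1 : I.kL ≤ 2 * J) (hJ2 : J ≤ I.kL - 1) (hJ3 : I.kS - 1 ≤ J) (hJ4 : J ≤ I.kLarge + 6)
    (hH : H1363 J) (hiter : I.S J + I.R J ≤ Cgks * I.epsJ J)
    -- signs
    (hCgks : 0 ≤ Cgks) (hCks : 0 ≤ Cks) (hr0pos : 0 < I.r0) (hη : 0 < η)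
    (hR : 0 ≤ I.R (J + 1)) (hS : 0 ≤ I.S (J + 1)) (he0 : 0 ≤ I.ε0) (heJ : 0 ≤ I.epsJ J) (hL : 0 ≤ I.L (J + 1))
    -- regional ≤ global ([KS] (9.4.7)–(9.4.9), l.24004–24010)
    (hRs : I.Rstar (J + 1) ≤ I.R (J + 1)) (hRe : I.Rext (J + 1) ≤ I.R (J + 1))
    (hRi : I.Rint (J + 1) ≤ I.R (J + 1)) (hRt : I.Rtop (J + 1) ≤ I.R (J + 1))
    (hsum : I.S (J + 1) ≤ I.Sstar (J + 1) + I.Sext (J + 1) + I.Sint (J + 1) + I.Stop (J + 1))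
    -- the two smallness conditions
    (hr0 : Cgks * I.r0 ^ (-I.δB / 2) * (Cks * (Cks + 1)) ≤ 1 / 4)
    (ha : (Cgks * Real.sqrt |I.a| * I.r0 ^ (3 + I.δB / 2)
            + thetaOf (Cgks * I.r0 ^ ((21 + I.δB) / 2)) (Cgks * I.r0 ^ ((39 : ℝ) / 8 + I.δB / 2))
                (Cgks * I.r0 ^ ((39 : ℝ) / 7 + 4 * I.δB / 7)) η) * (4 * (Cks + 1) ^ 3) ≤ 1 / 4) :
    I.R (J + 1) + I.S (J + 1)
      ≤ (1 + 4 * (Cks + 1) ^ 3)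
          * (2 * dataOf (Cgks * I.r0 ^ (21 + I.δB)) (Cgks * I.r0 ^ ((21 + I.δB) / 2))
                (Cgks * I.r0 ^ ((39 : ℝ) / 8 + I.δB / 2)) (Cgks * I.r0 ^ ((39 : ℝ) / 7 + 4 * I.δB / 7))
                η I.ε0 (I.epsJ J)
              + I.ε0 + I.L (J + 1) / 2)
        + 4 * (Cks + 1) ^ 3 * (I.ε0 + I.L (J + 1)) := by
  -- the instance of (13.6.8) at J, redistributed into the shape of `IterationAbsorption.formB_linearised`
  -- `hJ1` is the printed floor `k_L ≤ 2J`; `omega` discharges the node's floor binder under either of its typings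
  -- (`Dag` ≤ v8: `I.kL / 2 ≤ J`, implied by `hJ1`; `Dag` v9: `I.kL ≤ 2 * J`, = `hJ1`).
  have h0 := hB J (by omega) hJ2 hH hiter
  have h1368 : I.R (J + 1) ≤ (Cgks * I.r0 ^ (21 + I.δB)) * I.epsJ J
      + (Cgks * I.r0 ^ ((21 + I.δB) / 2)) * (Real.sqrt (I.S (J + 1)) * Real.sqrt (I.epsJ J) + I.ε0)
      + (Cgks * Real.sqrt |I.a| * I.r0 ^ (3 + I.δB / 2)) * I.S (J + 1)
      + (Cgks * I.r0 ^ (-I.δB / 2)) * I.Sext (J + 1)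
      + (Cgks * I.r0 ^ ((39 : ℝ) / 8 + I.δB / 2))
          * (I.S (J + 1) ^ (3 / 4 : ℝ) * (I.ε0 + Real.sqrt (I.epsJ J) * Real.sqrt (I.S (J + 1))) ^ (1 / 4 : ℝ))
      + (Cgks * I.r0 ^ ((39 : ℝ) / 7 + 4 * I.δB / 7)) * (I.S (J + 1) ^ (6 / 7 : ℝ) * I.epsJ J ^ (1 / 7 : ℝ)) := by
    refine h0.trans (le_of_eq ?_)
    ring
  -- the four Ricci estimates at J, turned into `hSext`, `hSle`
  obtain ⟨h17, h18, h19, h20⟩ := hP J hJ3 hJ4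
  obtain ⟨hSext, hSle⟩ := S_le_of_props hCks hR he0 hL h17 h18 h19 h20 hRs hRe hRi hRt hsum
  -- signs of the coefficients
  have hr0' : 0 ≤ I.r0 := hr0pos.le
  have hc2 : 0 ≤ Cgks * I.r0 ^ ((21 + I.δB) / 2) := mul_nonneg hCgks (Real.rpow_nonneg hr0' _)
  have hc3 : 0 ≤ Cgks * I.r0 ^ ((39 : ℝ) / 8 + I.δB / 2) := mul_nonneg hCgks (Real.rpow_nonneg hr0' _)
  have hc4 : 0 ≤ Cgks * I.r0 ^ ((39 : ℝ) / 7 + 4 * I.δB / 7) := mul_nonneg hCgks (Real.rpow_nonneg hr0' _)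
  have hα : 0 ≤ Cgks * Real.sqrt |I.a| * I.r0 ^ (3 + I.δB / 2) :=
    mul_nonneg (mul_nonneg hCgks (Real.sqrt_nonneg _)) (Real.rpow_nonneg hr0' _)
  have hβ : 0 ≤ Cgks * I.r0 ^ (-I.δB / 2) := mul_nonneg hCgks (Real.rpow_nonneg hr0' _)
  have hK3 : 0 ≤ 4 * (Cks + 1) ^ 3 := by positivity
  exact iterate_of_remark1364_named hR hS he0 heJ hL hα hβ hc2 hc3 hc4 hη hK3 h1368 hSext hSle ha hr0

end Ch9Iteration
end Literature.Geometry.Lorentzian.KlainermanSzeftel2021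

end
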